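import Literature.NumberTheory.ConnesMoscovici2022.UVProlateSpectrum
import Mathlib.Analysis.Fourier.LpSpace
import Mathlib.Analysis.Distribution.SchwartzSpace.Fourier
import Mathlib.Analysis.Calculus.Deriv.Star
import HarnessLib

/-!
# Connes–Moscovici 2022, Lemma 1.3: `W` commutes with `P_λ` and `P̂_λ` on `dom W_min` — PROOFS

LINE 1 — FRAMING. RH-FREE corpus literature (spectral theory of the prolate wave operator
`W_λ = −∂(λ² − x²)∂ + (2πλx)²` on `L²(ℝ)`; sequel row of the Connes–Consani corpus, no leaf / binder
role).  bears_on: LADDER-RH W-C/W-P.  WHAT THIS IS NOT: any claim about RH; nothing in this file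
mentions `RiemannHypothesis` or bears on the truth of RH.

This is the theorems-only companion of `UVProlateSpectrum.lean` (statements AS PRINTED).  It
DISCHARGES the named fact `CM22_lemma_1_3` (**Lemma 1.3** of A. Connes, H. Moscovici, *The UV prolate
spectrum matches the zeros of zeta*, PNAS 119 (2022) [bib: `ConnesMoscovici2022`] = arXiv:2112.05500
Lemma 2.3, chunk p0004:L106–p0005:L16 of the held text `paper:arxiv-2112.05500`):

> "If `ξ ∈ dom W_min` then `P_λ ξ ∈ dom W_max` and `W P_λ ξ = P_λ W ξ`. The same holds with respect
> to `P̂_λ`."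

following the PRINTED PROOF step by step:

* §B `hasDerivAt_wronskian`, `intervalIntegral_mul_prolateWaveOpFun_sub` — the Lagrange identity
  (1.5) for `[f, g] = p(fg′ − gf′)` and Green's formula on `[−λ, λ]` with no boundary terms ("Using
  twice integration by parts, together with the fact that `(λ² − x²)φ′` and `(λ² − x²)f′` vanish on
  the boundary").  SIGN NOTE: direct differentiation gives `d/dx [ξ, η] = η Wξ − ξ Wη`, the opposite
  of the printed display (1.5) (= arXiv (2.5)); immaterial for everything in print.
* §C–§E `prolateWaveOpFun_star`, `inner_toLp_cutoffProj_toLp`,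
  `inner_prolateSchwartz_cutoffProj_comm` — "`W` is real", and the core identity
  `⟪Wψ, P_λ φ⟫ = ⟪ψ, P_λ Wφ⟫` for Schwartz `ψ, φ` ("which shows that `W(P_λ f) = P_λ W f`").
* §A + §F `LinearPMap.adjoint_clm_apply_of_comm`, `cutoffProj_mem_prolateMax` — "by the density of
  `𝒮(ℝ)` in `dom W_min` for the graph norm": a closed-condition argument on the graph of the closure
  (Mathlib `LinearPMap.closure`, `LinearPMap.mem_adjoint_domain_of_exists`, `adjoint_apply_eq`;
  the pattern of the tree's `LinearPMap.IsPositive.of_graph_subset_closure`).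
* §G `fourier_prolateSchwartz` — "In addition `W` has the remarkable property of commuting with the
  Fourier transform" (§1 ¶1), PROVED on the Schwartz core from Mathlib's dictionary
  `SchwartzMap.fourier_lineDerivOp_eq` / `lineDerivOp_fourier_eq` (`𝓕∂ = 2πix·𝓕`, `∂𝓕 = −2πi𝓕x`;
  the tree's `Literature.Analysis.UnboundedOperators.neg_derivCLM_fourier_eq` is the same one-line
  dictionary, re-derived here privately to keep this file's imports inside the corpus).
* §H `inner_prolateSchwartz_cutoffProjHat_comm`, `cutoffProjHat_mem_prolateMax` — "The claim now
  follows from the fact that `W` commutes with `𝔽_{e_ℝ}`" (`P̂_λ` = the tree's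
  `ConnesConsani2021.cutoffProjHat = 𝓕⁻¹ P_λ 𝓕`, unitarity `Lp.inner_fourier_eq`, and
  `SchwartzMap.toLp_fourier_eq`).
* §I `CM22_lemma_1_3_holds`.

No definitions, no new named facts (net debt −1).  Nothing in this file bears on the truth of RH.
-/

noncomputable section

open Complex Set MeasureTheory Filter SchwartzMap
open scoped Real Topology FourierTransform ENNReal InnerProductSpace

/-! ## A. Generic: bounded operators commuting with a core pass to `T_min ↦ T_max` -/

namespace LinearPMap

variable {𝕜 E : Type*} [RCLike 𝕜] [NormedAddCommGroup E] [InnerProductSpace 𝕜 E]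

/-- (Dot-notation extension of Mathlib's `LinearPMap`, declared deliberately in that namespace.)
The graph of `T.closure` lies in the closure of the graph of `T` (Mathlib's `closure` is the honest
closure when `T` is closable and the junk value `T` otherwise; in both cases the inclusion holds;
compare the tree's `LinearPMap.HasCore.graph_subset_closure_graph_domRestrict`). [folklore] -/
private theorem graph_closure_subset_closure_graph (T : E →ₗ.[𝕜] E) :
    (T.closure.graph : Set (E × E)) ⊆ _root_.closure (T.graph : Set (E × E)) := by
  by_cases hT : T.IsClosable
  · rw [← hT.graph_closure_eq_closure_graph, Submodule.topologicalClosure_coe]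
  · rw [closure_def' hT]; exact subset_closure

variable [CompleteSpace E]

/-- (Dot-notation extension of Mathlib's `LinearPMap`, declared deliberately in that namespace.)
**Density argument** ("by the density of the core in `dom T_min` for the graph norm", Reed–Simon I
§VIII.1–2 style): if a bounded self-adjoint `B` satisfies `⟪T x, B y⟫ = ⟪x, B (T y)⟫ for `x, y` in
the (dense) domain of `T`, then for every `ξ ∈ dom T.closure` one has `B ξ ∈ dom T†` and
`T† (B ξ) = B (T.closure ξ)`: the relation `⟪T.closure ξ, B y⟫ = ⟪ξ, B (T y)⟫` is a closed condition
on the graph, and then Mathlib's `mem_adjoint_domain_of_exists` / `adjoint_apply_eq` apply.  This is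
exactly the step "by the density of `𝒮(ℝ)` in `dom W_min` for the graph norm it follows that
`ξ ∈ dom W_min ⟹ P_λ ξ ∈ dom W_max` and `W_max P_λ ξ = P_λ W ξ`" of the cited proof, stated for an
arbitrary densely defined `T` and bounded self-adjoint `B`.
[cite: ConnesMoscovici2022, proof of Lemma 1.3 (= arXiv Lemma 2.3, chunk p0005:L10–L14)] -/
theorem adjoint_clm_apply_of_comm {T : E →ₗ.[𝕜] E} (hT : Dense (T.domain : Set E))
    (B : E →L[𝕜] E) (hB : ∀ u v : E, ⟪B u, v⟫_𝕜 = ⟪u, B v⟫_𝕜)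
    (hcomm : ∀ x y : T.domain, ⟪T x, B (y : E)⟫_𝕜 = ⟪(x : E), B (T y)⟫_𝕜)
    (ξ : T.closure.domain) :
    ∃ h : B (ξ : E) ∈ T.adjoint.domain, T.adjoint ⟨B (ξ : E), h⟩ = B (T.closure ξ) := by
  have key : ∀ y : T.domain, ⟪T.closure ξ, B (y : E)⟫_𝕜 = ⟪(ξ : E), B (T y)⟫_𝕜 := by
    intro y
    have hmem : ((ξ : E), T.closure ξ) ∈ _root_.closure (T.graph : Set (E × E)) :=
      T.graph_closure_subset_closure_graph (T.closure.mem_graph ξ)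
    have hc : _root_.IsClosed {p : E × E | ⟪p.2, B (y : E)⟫_𝕜 = ⟪p.1, B (T y)⟫_𝕜} :=
      isClosed_eq (continuous_snd.inner continuous_const) (continuous_fst.inner continuous_const)
    have hsub : _root_.closure (T.graph : Set (E × E)) ⊆
        {p : E × E | ⟪p.2, B (y : E)⟫_𝕜 = ⟪p.1, B (T y)⟫_𝕜} := by
      refine hc.closure_subset_iff.mpr ?_
      intro q hq
      obtain ⟨x, hx1, hx2⟩ := (T.mem_graph_iff).mp hq
      show ⟪q.2, B (y : E)⟫_𝕜 = ⟪q.1, B (T y)⟫_𝕜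
      rw [← hx1, ← hx2]
      exact hcomm x y
    exact hsub hmem
  have hw : ∀ y : T.domain, ⟪B (T.closure ξ), (y : E)⟫_𝕜 = ⟪B (ξ : E), T y⟫_𝕜 := by
    intro y
    rw [hB, key y, ← hB]
  have hdom : B (ξ : E) ∈ T.adjoint.domain := mem_adjoint_domain_of_exists _ ⟨_, hw⟩
  exact ⟨hdom, adjoint_apply_eq hT ⟨_, hdom⟩ hw⟩

end LinearPMap

namespace Literature.NumberTheory.ConnesMoscovici2022

open Literature.NumberTheory.ConnesConsani2021 Literature.NumberTheory.ConnesConsani2024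

/-! ## B. The Lagrange identity and Green's formula on `[−λ, λ]` -/

/-- `p = λ² − x²` has derivative `−2x`. [folklore] -/
private theorem hasDerivAt_pCoeff (lam x : ℝ) :
    HasDerivAt (pCoeff lam) (((-(2 * x) : ℝ) : ℂ)) x := by
  have := ((hasDerivAt_pow 2 x).const_sub (lam ^ 2)).ofReal_comp
  unfold pCoeff
  simpa using this

/-- `p = λ² − x²` is smooth. [folklore] -/
private theorem contDiff_pCoeff (lam : ℝ) (n : ℕ∞) : ContDiff ℝ n (pCoeff lam) := by
  have h : ContDiff ℝ n (fun x : ℝ ↦ lam ^ 2 - x ^ 2) := by fun_prop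
  exact (Complex.ofRealCLM.contDiff.of_le le_top).comp h

/-- RH-FREE (PROVED). **The Lagrange identity** `d/dx [f, g] = g·Wf − f·Wg` for the prolate wave
operator `W = −∂p∂ + q` and the generalized Wronskian `[f, g] = p (f g′ − g f′)` (the file's
`wronskian`; `W` = the tree's `prolateWaveOpFun`).  SIGN: the printed display (1.5) (= arXiv (2.5))
reads `ξ Wη − η Wξ`; differentiating `p(ξη′ − ηξ′)` gives `ξ(pη′)′ − η(pξ′)′ = η Wξ − ξ Wη`, the
`q`-terms cancelling — the opposite sign, immaterial for every use in print (only the vanishing of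
boundary terms / the form `Ω` up to a global sign is used).
[cite: ConnesMoscovici2022, §1 eqs. (1.5)–(1.6) (= arXiv (2.5)–(2.6), chunk p0005:L31–L40)] -/
theorem hasDerivAt_wronskian (lam : ℝ) {f g : ℝ → ℂ} (hf : ContDiff ℝ 2 f) (hg : ContDiff ℝ 2 g)
    (x : ℝ) :
    HasDerivAt (wronskian lam f g)
      (g x * prolateWaveOpFun lam f x - f x * prolateWaveOpFun lam g x) x := by
  have hf1 : Differentiable ℝ f := hf.differentiable (by norm_num)
  have hg1 : Differentiable ℝ g := hg.differentiable (by norm_num)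
  have hf2 : Differentiable ℝ (deriv f) := hf.differentiable_deriv_two
  have hg2 : Differentiable ℝ (deriv g) := hg.differentiable_deriv_two
  -- `A = p g′`, `B = p f′`
  have hA : HasDerivAt (fun y ↦ pCoeff lam y * deriv g y)
      (deriv (fun y ↦ pCoeff lam y * deriv g y) x) x :=
    (((contDiff_pCoeff lam 1).differentiable (by simp) x).mul (hg2 x)).hasDerivAt
  have hB : HasDerivAt (fun y ↦ pCoeff lam y * deriv f y)
      (deriv (fun y ↦ pCoeff lam y * deriv f y) x) x :=
    (((contDiff_pCoeff lam 1).differentiable (by simp) x).mul (hf2 x)).hasDerivAt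
  have hW : wronskian lam f g =
      fun y ↦ f y * (pCoeff lam y * deriv g y) - g y * (pCoeff lam y * deriv f y) := by
    funext y; simp only [wronskian]; ring
  rw [hW]
  have h := ((hf1 x).hasDerivAt.mul hA).sub ((hg1 x).hasDerivAt.mul hB)
  refine h.congr_deriv ?_
  have eP : (fun y ↦ ((lam ^ 2 - y ^ 2 : ℝ) : ℂ) * deriv g y) = fun y ↦ pCoeff lam y * deriv g y := by
    funext y; rfl
  have eP' : (fun y ↦ ((lam ^ 2 - y ^ 2 : ℝ) : ℂ) * deriv f y) = fun y ↦ pCoeff lam y * deriv f y := by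
    funext y; rfl
  simp only [prolateWaveOpFun, eP, eP']
  ring

/-- The Wronskian vanishes at `λ` (`p(λ) = 0`). [cite: ConnesMoscovici2022, proof of Lemma 1.3 (= arXiv Lemma 2.3, chunk p0004:L116)] -/
private theorem wronskian_apply_lam (lam : ℝ) (f g : ℝ → ℂ) : wronskian lam f g lam = 0 := by
  simp [wronskian, pCoeff]

/-- The Wronskian vanishes at `−λ` (`p(−λ) = 0`). [cite: ConnesMoscovici2022, proof of Lemma 1.3 (= arXiv Lemma 2.3, chunk p0004:L116)] -/
private theorem wronskian_apply_neg_lam (lam : ℝ) (f g : ℝ → ℂ) : wronskian lam f g (-lam) = 0 := by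
  simp [wronskian, pCoeff]

/-- `W f` is continuous for `f ∈ C²(ℝ)`. [folklore] -/
private theorem continuous_prolateWaveOpFun (lam : ℝ) {f : ℝ → ℂ} (hf : ContDiff ℝ 2 f) :
    Continuous (prolateWaveOpFun lam f) := by
  have hf2 : ContDiff ℝ 1 (deriv f) := (contDiff_succ_iff_deriv.mp (show ContDiff ℝ (1 + 1) f from hf)).2.2
  have hPf : ContDiff ℝ 1 (fun y ↦ ((lam ^ 2 - y ^ 2 : ℝ) : ℂ) * deriv f y) :=
    (contDiff_pCoeff lam 1).mul hf2
  have h1 : Continuous (deriv fun y ↦ ((lam ^ 2 - y ^ 2 : ℝ) : ℂ) * deriv f y) :=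
    hPf.continuous_deriv_one
  have h2 : Continuous f := hf.continuous
  unfold prolateWaveOpFun
  fun_prop

/-- RH-FREE (PROVED). **Green's formula on `[−λ, λ]` without boundary terms**: "Using twice
integration by parts, together with the fact that `(λ² − x²)φ′(x)` and `(λ² − x²)f′(x)` vanish on
the boundary" — for `f, g ∈ C²(ℝ)`, `∫_{−λ}^{λ} (g·Wf − f·Wg) dx = [f, g](λ) − [f, g](−λ) = 0`.
[cite: ConnesMoscovici2022, proof of Lemma 1.3 (= arXiv Lemma 2.3, chunk p0004:L110–p0005:L8)] -/
theorem intervalIntegral_mul_prolateWaveOpFun_sub (lam : ℝ) {f g : ℝ → ℂ} (hf : ContDiff ℝ 2 f)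
    (hg : ContDiff ℝ 2 g) :
    ∫ x in (-lam)..lam, (g x * prolateWaveOpFun lam f x - f x * prolateWaveOpFun lam g x) = 0 := by
  have hcont : Continuous fun x ↦ g x * prolateWaveOpFun lam f x - f x * prolateWaveOpFun lam g x :=
    (hg.continuous.mul (continuous_prolateWaveOpFun lam hf)).sub
      (hf.continuous.mul (continuous_prolateWaveOpFun lam hg))
  rw [intervalIntegral.integral_eq_sub_of_hasDerivAt (fun x _ ↦ hasDerivAt_wronskian lam hf hg x)
    (hcont.intervalIntegrable _ _), wronskian_apply_lam, wronskian_apply_neg_lam, sub_zero]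

/-! ## C. `W` is real: it commutes with complex conjugation -/

/-- RH-FREE (PROVED). "`W` is real": `W(f̄) = \overline{W f}` pointwise.
[cite: ConnesMoscovici2022, §1 ¶1 (= arXiv §2 ¶1, chunk p0004:L14)] -/
theorem prolateWaveOpFun_star (lam : ℝ) (f : ℝ → ℂ) (x : ℝ) :
    prolateWaveOpFun lam (fun y ↦ star (f y)) x = star (prolateWaveOpFun lam f x) := by
  have h1 : (fun y ↦ ((lam ^ 2 - y ^ 2 : ℝ) : ℂ) * deriv (fun y ↦ star (f y)) y) =
      fun y ↦ star (((lam ^ 2 - y ^ 2 : ℝ) : ℂ) * deriv f y) := by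
    funext y
    rw [deriv.star', star_mul', Complex.star_def, Complex.conj_ofReal]
  unfold prolateWaveOpFun
  rw [h1, deriv.star]
  simp only [star_add, star_neg, star_mul', Complex.star_def, Complex.conj_ofReal, star_pow]

/-! ## D. Inner products against the cutoff projection as integrals over `[−λ, λ]` -/

/-- Unfolding: `schwartzToL2 f = f.toLp 2`. [folklore] -/
private theorem schwartzToL2_eq_toLp (f : 𝓢(ℝ, ℂ)) : schwartzToL2 f = f.toLp 2 volume := rfl

/-- RH-FREE (PROVED). `⟪u, P_λ v⟫ = ∫_{−λ}^{λ} v ū` for Schwartz `u, v` (Mathlib's inner product is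
antilinear in the first slot; `P_λ` = the tree's `cutoffProj`).
[cite: ConnesMoscovici2022, proof of Lemma 1.3 (= arXiv Lemma 2.3, chunk p0004:L110–L113)] -/
theorem inner_toLp_cutoffProj_toLp (lam : ℝ) (u v : 𝓢(ℝ, ℂ)) :
    ⟪(u.toLp 2 volume : L2R), cutoffProj lam (v.toLp 2 volume : L2R)⟫_ℂ =
      ∫ x in Icc (-lam) lam, v x * star (u x) := by
  rw [L2.inner_def, ← integral_indicator measurableSet_Icc]
  refine integral_congr_ae ?_
  filter_upwards [cutoffProj_coeFn lam (v.toLp 2 volume : L2R), u.coeFn_toLp 2 volume,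
    v.coeFn_toLp 2 volume] with x h1 h2 h3
  rw [h1, h2]
  by_cases hx : x ∈ Icc (-lam) lam
  · rw [indicator_of_mem hx, indicator_of_mem hx, h3]
    simp
  · rw [indicator_of_notMem hx, indicator_of_notMem hx, inner_zero_right]

/-! ## E. `W` commutes with `P_λ` on the core (in the weak sense) -/

/-- RH-FREE (PROVED). For Schwartz `ψ, φ`: `⟪Wψ, P_λ φ⟫ = ⟪ψ, P_λ Wφ⟫`, i.e.
`∫_{−λ}^{λ} φ \overline{Wψ} = ∫_{−λ}^{λ} (Wφ) ψ̄` — "which shows that `W(P_λ f) = P_λ W f`" for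
`f` in the core.
[cite: ConnesMoscovici2022, proof of Lemma 1.3 (= arXiv Lemma 2.3, chunk p0004:L110–p0005:L9)] -/
theorem inner_prolateSchwartz_cutoffProj_comm (lam : ℝ) (hlam : 0 ≤ lam) (ψ φ : 𝓢(ℝ, ℂ)) :
    ⟪((prolateSchwartz lam ψ).toLp 2 volume : L2R), cutoffProj lam (φ.toLp 2 volume : L2R)⟫_ℂ =
      ⟪(ψ.toLp 2 volume : L2R), cutoffProj lam ((prolateSchwartz lam φ).toLp 2 volume : L2R)⟫_ℂ := by
  rw [inner_toLp_cutoffProj_toLp, inner_toLp_cutoffProj_toLp]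
  have hψs : ContDiff ℝ 2 (fun y ↦ star (ψ y)) := by
    have := (Complex.conjCLE.contDiff (n := 2)).comp (ψ.smooth 2)
    exact this
  have key := intervalIntegral_mul_prolateWaveOpFun_sub lam hψs (φ.smooth 2)
  rw [intervalIntegral.integral_of_le (by linarith), ← integral_Icc_eq_integral_Ioc] at key
  simp_rw [prolateWaveOpFun_star, ← prolateSchwartz_apply] at key
  have hc1 : Continuous fun x ↦ φ x * star (prolateSchwartz lam ψ x) :=
    φ.continuous.mul (prolateSchwartz lam ψ).continuous.star
  have hc2 : Continuous fun x ↦ prolateSchwartz lam φ x * star (ψ x) :=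
    (prolateSchwartz lam φ).continuous.mul ψ.continuous.star
  have hsub := integral_sub (hc1.integrableOn_Icc (μ := volume) (a := -lam) (b := lam))
    (hc2.integrableOn_Icc (μ := volume) (a := -lam) (b := lam))
  have e : (fun x ↦ φ x * star (prolateSchwartz lam ψ x) - prolateSchwartz lam φ x * star (ψ x)) =
      fun x ↦ φ x * star (prolateSchwartz lam ψ x) - star (ψ x) * prolateSchwartz lam φ x := by
    funext x; ring
  rw [e, key] at hsub
  exact (sub_eq_zero.mp hsub.symm)

/-! ## F. Lemma 1.3, first clause: `P_λ` -/

/-- RH-FREE (PROVED). **Lemma 1.3, `P_λ` half**: for `ξ ∈ dom W_min`, `P_λ ξ ∈ dom W_max` and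
`W_max (P_λ ξ) = P_λ (W_min ξ)` — from the core identity by "the density of `𝒮(ℝ)` in `dom W_min`
for the graph norm" (`LinearPMap.adjoint_clm_apply_of_comm`).
[cite: ConnesMoscovici2022, Lemma 1.3 (= arXiv Lemma 2.3, chunk p0004:L106–p0005:L14)] -/
theorem cutoffProj_mem_prolateMax (lam : ℝ) (hlam : 0 < lam) (ξ : (prolateMin lam).domain) :
    ∃ h : cutoffProj lam ξ ∈ (prolateMax lam).domain,
      prolateMax lam ⟨cutoffProj lam ξ, h⟩ = cutoffProj lam (prolateMin lam ξ) := by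
  refine LinearPMap.adjoint_clm_apply_of_comm dense_schwartzL2 (cutoffProj lam) ?_ ?_ ξ
  · intro u v
    exact ContinuousLinearMap.isSelfAdjoint_iff_isSymmetric.mp (cutoffProj_isSelfAdjoint lam) u v
  · intro x y
    obtain ⟨ψ, hψ⟩ := LinearMap.mem_range.mp x.2
    obtain ⟨φ, hφ⟩ := LinearMap.mem_range.mp y.2
    have hx : x = ⟨schwartzToL2 ψ, LinearMap.mem_range_self _ ψ⟩ := Subtype.ext hψ.symm
    have hy : y = ⟨schwartzToL2 φ, LinearMap.mem_range_self _ φ⟩ := Subtype.ext hφ.symm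
    subst hx hy
    rw [prolateCore_apply, prolateCore_apply]
    exact inner_prolateSchwartz_cutoffProj_comm lam hlam.le ψ φ

/-! ## G. "`W` has the remarkable property of commuting with the Fourier transform" (on `𝒮(ℝ)`) -/

section Fourier

open LineDeriv

/-- `x ↦ ⟨x, 1⟩ = x` has temperate growth. [folklore] -/
private theorem inner_one_hasTemperateGrowth :
    (fun x : ℝ ↦ ⟪x, (1 : ℝ)⟫_ℝ).HasTemperateGrowth := by fun_prop

/-- The multiplication operator `u ↦ x·u` of Mathlib's Fourier/derivative dictionary
(`smulLeftCLM ℂ (⟪·, 1⟫_ℝ)`), evaluated. [folklore] -/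
private theorem smulLeftCLM_inner_one_apply (u : 𝓢(ℝ, ℂ)) (y : ℝ) :
    smulLeftCLM ℂ (fun x : ℝ ↦ ⟪x, (1 : ℝ)⟫_ℝ) u y = (y : ℂ) * u y := by
  rw [smulLeftCLM_apply_apply inner_one_hasTemperateGrowth]
  simp [Complex.real_smul]

/-- On `𝒮(ℝ)` the derivative is the line derivative in direction `1`. [folklore] -/
private theorem derivCLM_eq_lineDerivOp (u : 𝓢(ℝ, ℂ)) : derivCLM ℂ ℂ u = ∂_{(1 : ℝ)} u := by
  ext y
  rw [derivCLM_apply, lineDerivOp_apply_eq_fderiv, fderiv_apply_one_eq_deriv]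

/-- `𝓕` is `ℂ`-linear on `𝒮(ℝ)` (pinned-type restatements of Mathlib's class lemmas). [folklore] -/
private theorem fourier_sub' (u v : 𝓢(ℝ, ℂ)) : (𝓕 (u - v) : 𝓢(ℝ, ℂ)) = 𝓕 u - 𝓕 v :=
  map_sub (FourierTransform.fourierCLM ℂ 𝓢(ℝ, ℂ)) u v

/-- `𝓕 (u + v) = 𝓕 u + 𝓕 v` on `𝒮(ℝ)`. [folklore] -/
private theorem fourier_add' (u v : 𝓢(ℝ, ℂ)) : (𝓕 (u + v) : 𝓢(ℝ, ℂ)) = 𝓕 u + 𝓕 v :=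
  map_add (FourierTransform.fourierCLM ℂ 𝓢(ℝ, ℂ)) u v

/-- `𝓕 (−u) = −𝓕 u` on `𝒮(ℝ)`. [folklore] -/
private theorem fourier_neg' (u : 𝓢(ℝ, ℂ)) : (𝓕 (-u) : 𝓢(ℝ, ℂ)) = -𝓕 u :=
  map_neg (FourierTransform.fourierCLM ℂ 𝓢(ℝ, ℂ)) u

/-- `𝓕 (c • u) = c • 𝓕 u` on `𝒮(ℝ)`. [folklore] -/
private theorem fourier_smul' (c : ℂ) (u : 𝓢(ℝ, ℂ)) : (𝓕 (c • u) : 𝓢(ℝ, ℂ)) = c • 𝓕 u :=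
  map_smul (FourierTransform.fourierCLM ℂ 𝓢(ℝ, ℂ)) c u

/-- RH-FREE (PROVED). `𝓕(u′)(y) = 2πiy·𝓕u(y)` on `𝒮(ℝ)` (Mathlib's `fourier_lineDerivOp_eq`,
kernel `e^{−2πixy}` as in (1.3)). [cite: ConnesMoscovici2022, §1 eq. (1.3) (= arXiv (2.3), chunk p0004:L24–L26)] -/
private theorem fourier_derivCLM_apply (u : 𝓢(ℝ, ℂ)) (y : ℝ) :
    𝓕 (derivCLM ℂ ℂ u) y = 2 * π * I * y * 𝓕 u y := by
  rw [derivCLM_eq_lineDerivOp, fourier_lineDerivOp_eq, smul_apply, smulLeftCLM_inner_one_apply,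
    smul_eq_mul]
  ring

/-- RH-FREE (PROVED). `(𝓕u)′(y) = −2πi·𝓕(x u)(y)` on `𝒮(ℝ)` (Mathlib's `lineDerivOp_fourier_eq`;
the same dictionary as the tree's `Literature.Analysis.UnboundedOperators.neg_derivCLM_fourier_eq`).
[cite: ConnesMoscovici2022, §1 eq. (1.3) (= arXiv (2.3), chunk p0004:L24–L26)] -/
private theorem deriv_fourier_eq (u : 𝓢(ℝ, ℂ)) :
    deriv (⇑(𝓕 u : 𝓢(ℝ, ℂ))) =
      fun y ↦ -(2 * π * I) * 𝓕 (smulLeftCLM ℂ (fun x : ℝ ↦ ⟪x, (1 : ℝ)⟫_ℝ) u) y := by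
  funext y
  rw [← derivCLM_apply (𝕜 := ℂ), derivCLM_eq_lineDerivOp, lineDerivOp_fourier_eq, fourier_smul',
    smul_apply, smul_eq_mul]

/-- RH-FREE (PROVED). `𝓕(x²u)(y) = −(4π²)⁻¹ (𝓕u)″(y)` on `𝒮(ℝ)`.
[cite: ConnesMoscovici2022, §1 eq. (1.3) (= arXiv (2.3), chunk p0004:L24–L26)] -/
private theorem fourier_mulX_mulX_apply (u : 𝓢(ℝ, ℂ)) (y : ℝ) :
    𝓕 (smulLeftCLM ℂ (fun x : ℝ ↦ ⟪x, (1 : ℝ)⟫_ℝ)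
        (smulLeftCLM ℂ (fun x : ℝ ↦ ⟪x, (1 : ℝ)⟫_ℝ) u)) y =
      -(1 / (4 * π ^ 2)) * deriv (deriv ⇑(𝓕 u : 𝓢(ℝ, ℂ))) y := by
  have h2 := deriv_fourier_eq u
  have h1 := deriv_fourier_eq (smulLeftCLM ℂ (fun x : ℝ ↦ ⟪x, (1 : ℝ)⟫_ℝ) u)
  rw [h2, deriv_const_mul_field, h1]
  set c : ℂ := 1 / (4 * π ^ 2) with hc
  have hc' : 4 * π ^ 2 * c = 1 := by
    have hπ : (π : ℂ) ≠ 0 := by exact_mod_cast Real.pi_ne_zero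
    rw [hc]; field_simp
  have hI : I * I = -1 := I_mul_I
  set T := 𝓕 (smulLeftCLM ℂ (fun x : ℝ ↦ ⟪x, (1 : ℝ)⟫_ℝ)
        (smulLeftCLM ℂ (fun x : ℝ ↦ ⟪x, (1 : ℝ)⟫_ℝ) u)) y with hT
  linear_combination (4 * π ^ 2 * c * T) * hI + (-T) * hc'

/-- `p·v = λ² v − x²v` in `𝒮(ℝ)`. [cite: ConnesMoscovici2022, §1 eq. (1.1) (= arXiv (2.1), chunk p0004:L5–L9)] -/
private theorem smulLeftCLM_pCoeff_eq (lam : ℝ) (v : 𝓢(ℝ, ℂ)) :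
    smulLeftCLM ℂ (pCoeff lam) v =
      ((lam : ℂ) ^ 2) • v - smulLeftCLM ℂ (fun x : ℝ ↦ ⟪x, (1 : ℝ)⟫_ℝ)
        (smulLeftCLM ℂ (fun x : ℝ ↦ ⟪x, (1 : ℝ)⟫_ℝ) v) := by
  ext y
  rw [smulLeftCLM_apply_apply (pCoeff_hasTemperateGrowth lam), sub_apply, smul_apply,
    smulLeftCLM_inner_one_apply, smulLeftCLM_inner_one_apply, smul_eq_mul, smul_eq_mul, pCoeff]
  push_cast
  ring

/-- `q·v = (2πλ)² x²v` in `𝒮(ℝ)`. [cite: ConnesMoscovici2022, §1 eq. (1.1) (= arXiv (2.1), chunk p0004:L5–L9)] -/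
private theorem smulLeftCLM_qCoeff_eq (lam : ℝ) (v : 𝓢(ℝ, ℂ)) :
    smulLeftCLM ℂ (qCoeff lam) v =
      ((2 * π * lam : ℂ) ^ 2) • smulLeftCLM ℂ (fun x : ℝ ↦ ⟪x, (1 : ℝ)⟫_ℝ)
        (smulLeftCLM ℂ (fun x : ℝ ↦ ⟪x, (1 : ℝ)⟫_ℝ) v) := by
  ext y
  rw [smulLeftCLM_apply_apply (qCoeff_hasTemperateGrowth lam), smul_apply,
    smulLeftCLM_inner_one_apply, smulLeftCLM_inner_one_apply, smul_eq_mul, smul_eq_mul, qCoeff]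
  push_cast
  ring

/-- `(c·y·g)″ = c(2g′ + y g″)` for Schwartz `g`. [folklore] -/
private theorem deriv_deriv_mul_id (c : ℂ) (g : 𝓢(ℝ, ℂ)) (y : ℝ) :
    deriv (deriv fun t : ℝ ↦ c * t * g t) y = c * (2 * deriv g y + y * deriv (deriv g) y) := by
  have hg2 : Differentiable ℝ (deriv g) := (g.smooth 2).differentiable_deriv_two
  have h1 : deriv (fun t : ℝ ↦ c * t * g t) = fun t ↦ c * (g t + t * deriv g t) := by
    funext t
    have ht : HasDerivAt (fun t : ℝ ↦ c * (t : ℂ)) c t := by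
      simpa using ((hasDerivAt_id t).ofReal_comp).const_mul c
    have h : HasDerivAt (fun t : ℝ ↦ c * (t : ℂ) * g t) (c * g t + c * (t : ℂ) * deriv g t) t :=
      ht.mul (g.hasDerivAt t)
    rw [h.deriv]
    ring
  rw [h1]
  have ht : HasDerivAt (fun t : ℝ ↦ (t : ℂ)) 1 y := by
    simpa using (hasDerivAt_id y).ofReal_comp
  have h2 : HasDerivAt (fun t : ℝ ↦ g t + t * deriv g t)
      (deriv g y + (1 * deriv g y + y * deriv (deriv g) y)) y :=
    (g.hasDerivAt y).add (ht.mul (hg2 y).hasDerivAt)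
  rw [deriv_const_mul_field, h2.deriv]
  ring

/-- RH-FREE (PROVED). **`W` commutes with the Fourier transform on the Schwartz core**:
`𝔽_{e_ℝ}(W f) = W(𝔽_{e_ℝ} f)` for `f ∈ 𝒮(ℝ)` ("In addition `W` has the remarkable property of
commuting with the Fourier transform").  Proof: Mathlib's dictionary `𝓕∂ = 2πi x 𝓕`,
`∂𝓕 = −2πi 𝓕x` applied to `W = −λ²∂² + ∂x²∂ + (2πλ)²x²`.
[cite: ConnesMoscovici2022, §1 ¶1, eq. (1.3) (= arXiv §2 ¶1, (2.3), chunk p0004:L29–L37)] -/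
theorem fourier_prolateSchwartz (lam : ℝ) (f : 𝓢(ℝ, ℂ)) :
    𝓕 (prolateSchwartz lam f) = prolateSchwartz lam (𝓕 f) := by
  ext y
  set g : 𝓢(ℝ, ℂ) := 𝓕 f with hg
  -- the left-hand side
  have hWf : prolateSchwartz lam f =
      -(derivCLM ℂ ℂ (smulLeftCLM ℂ (pCoeff lam) (derivCLM ℂ ℂ f))) +
        smulLeftCLM ℂ (qCoeff lam) f := rfl
  have hFDf : ⇑(𝓕 (derivCLM ℂ ℂ f) : 𝓢(ℝ, ℂ)) = fun t : ℝ ↦ 2 * π * I * t * g t := by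
    funext t; rw [fourier_derivCLM_apply]
  have hL : 𝓕 (prolateSchwartz lam f) y =
      -(2 * π * I * y * ((lam : ℂ) ^ 2 * (2 * π * I * y * g y) -
          -(1 / (4 * π ^ 2)) * (2 * π * I * (2 * deriv g y + y * deriv (deriv g) y)))) +
        (2 * π * lam : ℂ) ^ 2 * (-(1 / (4 * π ^ 2)) * deriv (deriv g) y) := by
    rw [hWf, fourier_add', fourier_neg', add_apply, neg_apply, fourier_derivCLM_apply,
      smulLeftCLM_pCoeff_eq, fourier_sub', fourier_smul', sub_apply, smul_apply, smul_eq_mul,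
      fourier_derivCLM_apply, fourier_mulX_mulX_apply, hFDf, deriv_deriv_mul_id,
      smulLeftCLM_qCoeff_eq, fourier_smul', smul_apply, smul_eq_mul, fourier_mulX_mulX_apply]
  -- the right-hand side
  have hg2 : Differentiable ℝ (deriv g) := (g.smooth 2).differentiable_deriv_two
  have hB : HasDerivAt (fun t : ℝ ↦ ((lam ^ 2 - t ^ 2 : ℝ) : ℂ) * deriv g t)
      (((-(2 * y) : ℝ) : ℂ) * deriv g y + ((lam ^ 2 - y ^ 2 : ℝ) : ℂ) * deriv (deriv g) y) y :=
    (hasDerivAt_pCoeff lam y).mul (hg2 y).hasDerivAt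
  have hR : prolateSchwartz lam g y =
      -((((-(2 * y) : ℝ) : ℂ) * deriv g y + ((lam ^ 2 - y ^ 2 : ℝ) : ℂ) * deriv (deriv g) y)) +
        ((2 * π * lam * y : ℝ) : ℂ) ^ 2 * g y := by
    rw [prolateSchwartz_apply, prolateWaveOpFun, hB.deriv]
  rw [hL, hR]
  set c : ℂ := 1 / (4 * π ^ 2) with hc
  have hc' : 4 * π ^ 2 * c = 1 := by
    have hπ : (π : ℂ) ≠ 0 := by exact_mod_cast Real.pi_ne_zero
    rw [hc]; field_simp
  have hI : I * I = -1 := I_mul_I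
  push_cast
  linear_combination (-(4 * π ^ 2 * (lam : ℂ) ^ 2 * y ^ 2 * g y) -
      y * (2 * deriv g y + y * deriv (deriv g) y)) * hI +
    (-(y * (2 * deriv g y + y * deriv (deriv g) y)) * I * I - (lam : ℂ) ^ 2 * deriv (deriv g) y) *
      hc'

end Fourier

/-! ## H. `W` commutes with `P̂_λ = 𝓕⁻¹ P_λ 𝓕` on the core, and Lemma 1.3, second clause -/

/-- RH-FREE (PROVED). For Schwartz `ψ, φ`: `⟪Wψ, P̂_λ φ⟫ = ⟪ψ, P̂_λ Wφ⟫` (`P̂_λ` = the tree's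
`cutoffProjHat` = `𝓕⁻¹ P_λ 𝓕` on `L²(ℝ)`): by unitarity of `𝓕` and `𝓕W = W𝓕` this is the
`P_λ`-identity for `𝓕ψ, 𝓕φ` — "The claim now follows from the fact that `W` commutes with `𝔽_{e_ℝ}`".
[cite: ConnesMoscovici2022, proof of Lemma 1.3 (= arXiv Lemma 2.3, chunk p0005:L16)] -/
theorem inner_prolateSchwartz_cutoffProjHat_comm (lam : ℝ) (hlam : 0 ≤ lam) (ψ φ : 𝓢(ℝ, ℂ)) :
    ⟪((prolateSchwartz lam ψ).toLp 2 volume : L2R), cutoffProjHat lam (φ.toLp 2 volume : L2R)⟫_ℂ =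
      ⟪(ψ.toLp 2 volume : L2R),
        cutoffProjHat lam ((prolateSchwartz lam φ).toLp 2 volume : L2R)⟫_ℂ := by
  rw [cutoffProjHat_apply, cutoffProjHat_apply,
    ← Lp.inner_fourier_eq ((prolateSchwartz lam ψ).toLp 2 volume : L2R),
    FourierTransform.fourier_fourierInv_eq,
    ← Lp.inner_fourier_eq (ψ.toLp 2 volume : L2R), FourierTransform.fourier_fourierInv_eq,
    SchwartzMap.toLp_fourier_eq, SchwartzMap.toLp_fourier_eq, SchwartzMap.toLp_fourier_eq,
    SchwartzMap.toLp_fourier_eq, fourier_prolateSchwartz, fourier_prolateSchwartz]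
  exact inner_prolateSchwartz_cutoffProj_comm lam hlam (𝓕 ψ) (𝓕 φ)

/-- RH-FREE (PROVED). **Lemma 1.3, `P̂_λ` half**: for `ξ ∈ dom W_min`, `P̂_λ ξ ∈ dom W_max` and
`W_max (P̂_λ ξ) = P̂_λ (W_min ξ)`.
[cite: ConnesMoscovici2022, Lemma 1.3 (= arXiv Lemma 2.3, chunk p0004:L106–p0005:L16)] -/
theorem cutoffProjHat_mem_prolateMax (lam : ℝ) (hlam : 0 < lam) (ξ : (prolateMin lam).domain) :
    ∃ h : cutoffProjHat lam ξ ∈ (prolateMax lam).domain,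
      prolateMax lam ⟨cutoffProjHat lam ξ, h⟩ = cutoffProjHat lam (prolateMin lam ξ) := by
  refine LinearPMap.adjoint_clm_apply_of_comm dense_schwartzL2 (cutoffProjHat lam) ?_ ?_ ξ
  · intro u v
    exact ContinuousLinearMap.isSelfAdjoint_iff_isSymmetric.mp
      (isStarProjection_cutoffProjHat lam).isSelfAdjoint u v
  · intro x y
    obtain ⟨ψ, hψ⟩ := LinearMap.mem_range.mp x.2
    obtain ⟨φ, hφ⟩ := LinearMap.mem_range.mp y.2
    have hx : x = ⟨schwartzToL2 ψ, LinearMap.mem_range_self _ ψ⟩ := Subtype.ext hψ.symm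
    have hy : y = ⟨schwartzToL2 φ, LinearMap.mem_range_self _ φ⟩ := Subtype.ext hφ.symm
    subst hx hy
    rw [prolateCore_apply, prolateCore_apply]
    exact inner_prolateSchwartz_cutoffProjHat_comm lam hlam.le ψ φ

/-! ## I. Discharge of the named fact -/

/-- **Discharge** of the named fact `CM22_lemma_1_3` (RH-FREE, PROVED): **Lemma 1.3** (= arXiv
Lemma 2.3) of Connes–Moscovici — "If `ξ ∈ dom W_min` then `P_λ ξ ∈ dom W_max` and
`W P_λ ξ = P_λ W ξ`. The same holds with respect to `P̂_λ`" — following the printed proof: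
Green's formula on `[−λ, λ]` for the core (`inner_prolateSchwartz_cutoffProj_comm`), the density of
the core in `dom W_min` for the graph norm (`LinearPMap.adjoint_clm_apply_of_comm`), and the
commutation of `W` with `𝔽_{e_ℝ}` (`fourier_prolateSchwartz`).
[cite: ConnesMoscovici2022, Lemma 1.3 (= arXiv:2112.05500 Lemma 2.3, chunk p0004:L106–p0005:L16)] -/
theorem CM22_lemma_1_3_holds : CM22_lemma_1_3 := fun lam hlam ξ ↦
  ⟨cutoffProj_mem_prolateMax lam hlam ξ, cutoffProjHat_mem_prolateMax lam hlam ξ⟩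

end Literature.NumberTheory.ConnesMoscovici2022
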